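import Summits.QuantumFields.YangMills.Theorems.VirialFluxGapToronSoftnessSharp
import Summits.QuantumFields.YangMills.Theorems.SwapVirialDeficitSwapGluedStiffnessOfBulkRest
import HarnessLib

/-!
# Route `SwapVirialDeficit` ∕ `VirialFluxGap` (YangMills): ⟨24194⟩ `SwapMeanActionGap` ⇐ THE PER-SECTOR SHARP LAPLACE LAWS (S) ALONE —
# the periodic side (P) is a theorem (✓`gibbsMeanWindow_sharp`, fcl-p3 g47 after this seat's sockets)

LEAD ym-line-sfw-p2 g97 (cell ym-idea-1, free hands; `--supports stmt-QuantumFields-24194`).  With ⟨24196⟩ `ToronSoftnessSharp` CLOSED (fcl-p3 g47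
✓`toronSoftnessSharp_proof`, p829544) and the δ-family of patched Euler fields exposed by name (✓`smoothFrameFieldFamily_sharp`, ✓`gibbsMeanWindow_sharp` = the
one-sided sharp window bound (P) `β⟨F₀⟩_β ≤ 9L⁴ − 3/2 + δ′` for the PERIODIC ring — one-sided is the truth: the central torons carry a `log β`), the periodic half of
✓`SectorMixture.swapMeanActionGap_of_gibbsMeanWindow_of_sharpSectorLaplace` is discharged:

* ★★★ `swapMeanActionGap_of_sharpSectorLaplace` — ⟨24194⟩ `Theses.SwapVirialDeficit.SwapMeanActionGap` (the statement the route's `closes` consumes) from the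
  two PER-SECTOR sharp two-sided Laplace laws (S) of the σ-glued ring ALONE (`z = 000, 001`, free constants `C_z(L)`, `9L⁴ − 1 ≤ e_z(L) ≤ 9L⁴`, power rate
  `K·L^q·b^{−θ}` on a window) — via ✓`swapMeanActionGap_of_smoothFrameFieldFamily_cutoff_of_sharpSectorLaplace`.  After today the route's residue is (S) only.
* ★★★ `SwapRing.swapMeanActionGap_of_bulk_rest` — the same from w2 g58's per-sector, per-`(L,b)` POLYNOMIAL BULK∕REST DATA (the exact hypotheses of
  ✓`swapGluedStiffness_of_bulk_rest`, via ✓`sharpLaw_on_window_of_bulk_rest`): so ONE set of Morse–Bott data (bulk two-sided at rate `b^{−1/2}`, non-negative rest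
  at rate `b^{−θ₃}`, both relative to the main term `(2π∕b)^{e_z}𝔐_z(L)`) closes ⟨24197⟩ AND ⟨24194⟩ by name.

HONEST LABEL: a one-line composition of landed theorems (g47's S1–S6 and family, this seat's E1–E3 ∕ S6-central ∕ ✓p827990, fcl-p3 g41's assembly, w2∕w3's
central field and sockets);
⟨24196⟩ is CLOSED (p829544), ⟨24194⟩ ∕ ⟨24197⟩ OPEN pending (S); own crux ⟨22884⟩ OPEN (blocked-on ⟨19935⟩); the Yang–Mills mass gap is NOT proved; no
summit is proved by a line.  THEOREMS ONLY (0 `def`, 0 `sorry`), standard axioms.  References: [cite: Griffiths1964]; [cite: Luscher1983, §2]; [cite: tHooft1979].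
-/

set_option autoImplicit false

noncomputable section

open scoped Matrix BigOperators ContDiff Topology Quaternion
open MeasureTheory Set Matrix
open Literature.MathematicalPhysics.QuantumFieldTheory hiding SU2
open Literature.MathematicalPhysics.QuantumLattice

namespace Summit.QuantumFields.YangMills.Theorems.VirialFluxGap.FrameHessian

open Summit.QuantumFields.YangMills.Theorems.FemtoTransferGap
open Summit.QuantumFields.YangMills.Theorems.FemtoTransferGap.TT
open Summit.QuantumFields.YangMills.Theorems.FemtoTransferGap.TwoLattice
open Summit.QuantumFields.YangMills.Theorems.FemtoTransferGap.TwoLattice.Flat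
open Summit.QuantumFields.YangMills.Theorems.VirialFluxGap.RingDeficit
open Summit.QuantumFields.YangMills.Theorems.VirialFluxGap.FrameDerivative
open Summit.QuantumFields.YangMills.Theorems.VirialFluxGap.ResolventField
open Summit.QuantumFields.YangMills.Theorems.VirialFluxGap.RegularValley
open Summit.QuantumFields.YangMills.Theorems.VirialFluxGap.FixFrame
open Summit.QuantumFields.YangMills.Theorems.VirialFluxGap.RegCutoff
open Summit.QuantumFields.YangMills.Theorems.VirialFluxGap.FixField
open Summit.QuantumFields.YangMills.Theorems.VirialFluxGap.PatchingBudget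

open scoped Matrix.Norms.Frobenius

/-! ## ⟨24194⟩ from (S) alone -/

/-- ★★★ **⟨24194⟩ `SwapVirialDeficit.SwapMeanActionGap` FROM THE PER-SECTOR SHARP LAPLACE LAWS (S) ALONE.**  If for the two even seam sectors
`z = 000` (`fun _ => false`) and `z = 001` (`fun k => decide (k = 2)`) of the σ-glued ring there are exponents `9L⁴ − 1 ≤ e_z(L) ≤ 9L⁴`, free constants
`C_z(L)` and a two-sided power-rate law `|log ∫e^{−bF^S_z}dμ_ring − (−e_z(L) log b + C_z(L))| ≤ K·L^q·b^{−θ}` on a window `L ≤ b^a`, then the route's residue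
`SwapMeanActionGap` holds — the periodic side (P) is the theorem ✓`smoothFrameFieldFamily_sharp` ∕ ✓`gibbsMeanWindow_sharp`. [cite: tHooft1979] [cite: Luscher1983, §2] [cite: Griffiths1964] -/
theorem swapMeanActionGap_of_sharpSectorLaplace
    (hS : ∃ a : ℝ, 0 < a ∧ ∃ K : ℝ, 0 < K ∧ ∃ q : ℝ, 0 ≤ q ∧ ∃ θ : ℝ, 0 < θ ∧ θ ≤ 1 ∧ ∃ e₀ e₁ C₀ C₁ : ℕ → ℝ, ∃ β₀ : ℝ, ∃ L₀ : ℕ,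
      (∀ L : ℕ, L₀ ≤ L → 9 * (L : ℝ) ^ 4 - 1 ≤ e₀ L ∧ e₀ L ≤ 9 * (L : ℝ) ^ 4 ∧ 9 * (L : ℝ) ^ 4 - 1 ≤ e₁ L ∧ e₁ L ≤ 9 * (L : ℝ) ^ 4) ∧
      ∀ b : ℝ, β₀ ≤ b → ∀ (L : ℕ) [NeZero L], L₀ ≤ L → (L : ℝ) ≤ b ^ a →
        |Real.log (∫ P, Real.exp (-(b * Summit.QuantumFields.YangMills.Theorems.SwapVirialDeficit.SwapRing.swapRingDeficit L (fun _ => false) P)) ∂(ringMeasure L)) -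
            (-(e₀ L) * Real.log b + C₀ L)| ≤ K * (L : ℝ) ^ q * b ^ (-θ) ∧
        |Real.log (∫ P, Real.exp (-(b * Summit.QuantumFields.YangMills.Theorems.SwapVirialDeficit.SwapRing.swapRingDeficit L (fun k => decide (k = 2)) P)) ∂(ringMeasure L)) -
            (-(e₁ L) * Real.log b + C₁ L)| ≤ K * (L : ℝ) ^ q * b ^ (-θ)) :
    Summit.QuantumFields.YangMills.Theses.SwapVirialDeficit.SwapMeanActionGap :=
  swapMeanActionGap_of_smoothFrameFieldFamily_cutoff_of_sharpSectorLaplace smoothFrameFieldFamily_sharp hS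

end Summit.QuantumFields.YangMills.Theorems.VirialFluxGap.FrameHessian

/-! ## ⟨24194⟩ from per-sector bulk∕rest data -/

namespace Summit.QuantumFields.YangMills.Theorems.SwapVirialDeficit.SwapRing

open Summit.QuantumFields.YangMills.Theorems.FemtoTransferGap
open Summit.QuantumFields.YangMills.Theorems.VirialFluxGap.RingDeficit
open Summit.QuantumFields.YangMills.Theorems.QuantitativeLaplace

/-- ★★★ **⟨24194⟩ `SwapMeanActionGap` FROM PER-SECTOR, PER-`(L,b)` POLYNOMIAL BULK∕REST DATA** (the exact hypotheses of w2 g58's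
✓`swapGluedStiffness_of_bulk_rest`).  For each even sector `z₀ = 000`, `z₁ = 001`: exponents `9L⁴ − 1 ≤ e_z L ≤ 9L⁴`, main constants `𝔐_z L > 0`, and for
`L ≥ L₀ ≥ 1`, `b ≥ K₁L^{q₁}`, a decomposition `I_bulk ≤ Ẑ_z(L,b) ≤ I_bulk + R` of `Ẑ_z(L,b) = ∫ e^{−bF^S_z} dμ_L` with
`|I_bulk − (2π∕b)^{e_z L}𝔐_z L| ≤ K₂L^{q₂}b^{−1∕2}·Main` and `R ≤ K₃L^{q₃}b^{−θ₃}·Main`.  Then `SwapMeanActionGap` — w2's proof verbatim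
(✓`sharpLaw_on_window_of_bulk_rest` twice, common window) with the final consumer ✓`swapMeanActionGap_of_sharpSectorLaplace`; together with
✓`swapGluedStiffness_of_bulk_rest` ONE set of Morse–Bott data closes ⟨24197⟩ and ⟨24194⟩. [cite: tHooft1979] [cite: Luscher1983, §2] [folklore] -/
theorem swapMeanActionGap_of_bulk_rest {e₀ e₁ 𝔐₀ 𝔐₁ : ℕ → ℝ} {K₁ K₂ K₃ θ₃ : ℝ} {q₁ q₂ q₃ L₀ : ℕ}
    (hK₁ : 0 < K₁) (hK₂ : 0 ≤ K₂) (hK₃ : 0 ≤ K₃) (hθ₃ : 0 < θ₃) (hq₁ : 1 ≤ q₁) (hL₀ : 1 ≤ L₀)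
    (hexp : ∀ L : ℕ, L₀ ≤ L → 9 * (L : ℝ) ^ 4 - 1 ≤ e₀ L ∧ e₀ L ≤ 9 * (L : ℝ) ^ 4 ∧ 9 * (L : ℝ) ^ 4 - 1 ≤ e₁ L ∧ e₁ L ≤ 9 * (L : ℝ) ^ 4)
    (h𝔐₀ : ∀ L : ℕ, L₀ ≤ L → 0 < 𝔐₀ L) (h𝔐₁ : ∀ L : ℕ, L₀ ≤ L → 0 < 𝔐₁ L)
    (h₀ : ∀ (L : ℕ) [NeZero L], L₀ ≤ L → ∀ b : ℝ, K₁ * (L : ℝ) ^ q₁ ≤ b → ∃ Ib R : ℝ,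
      Ib ≤ ∫ P, Real.exp (-(b * swapRingDeficit L (fun _ => false) P)) ∂(ringMeasure L) ∧
      (∫ P, Real.exp (-(b * swapRingDeficit L (fun _ => false) P)) ∂(ringMeasure L)) ≤ Ib + R ∧
      |Ib - (2 * Real.pi / b) ^ (e₀ L) * 𝔐₀ L| ≤ (K₂ * (L : ℝ) ^ q₂ * b ^ (-(1 / 2 : ℝ))) * ((2 * Real.pi / b) ^ (e₀ L) * 𝔐₀ L) ∧
      R ≤ (K₃ * (L : ℝ) ^ q₃ * b ^ (-θ₃)) * ((2 * Real.pi / b) ^ (e₀ L) * 𝔐₀ L))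
    (h₁ : ∀ (L : ℕ) [NeZero L], L₀ ≤ L → ∀ b : ℝ, K₁ * (L : ℝ) ^ q₁ ≤ b → ∃ Ib R : ℝ,
      Ib ≤ ∫ P, Real.exp (-(b * swapRingDeficit L (fun k => decide (k = 2)) P)) ∂(ringMeasure L) ∧
      (∫ P, Real.exp (-(b * swapRingDeficit L (fun k => decide (k = 2)) P)) ∂(ringMeasure L)) ≤ Ib + R ∧
      |Ib - (2 * Real.pi / b) ^ (e₁ L) * 𝔐₁ L| ≤ (K₂ * (L : ℝ) ^ q₂ * b ^ (-(1 / 2 : ℝ))) * ((2 * Real.pi / b) ^ (e₁ L) * 𝔐₁ L) ∧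
      R ≤ (K₃ * (L : ℝ) ^ q₃ * b ^ (-θ₃)) * ((2 * Real.pi / b) ^ (e₁ L) * 𝔐₁ L)) :
    Summit.QuantumFields.YangMills.Theses.SwapVirialDeficit.SwapMeanActionGap := by
  -- the two sector integrals as total functions of `L` (value `0` at the excluded `L = 0`)
  let I₀ : ℕ → ℝ → ℝ := fun L b =>
    if h : L = 0 then 0 else ∫ P, Real.exp (-(b * @swapRingDeficit L ⟨h⟩ (fun _ => false) P)) ∂(@ringMeasure L ⟨h⟩)
  let I₁ : ℕ → ℝ → ℝ := fun L b =>
    if h : L = 0 then 0 else ∫ P, Real.exp (-(b * @swapRingDeficit L ⟨h⟩ (fun k => decide (k = 2)) P)) ∂(@ringMeasure L ⟨h⟩)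
  have hI₀ : ∀ (L : ℕ) [NeZero L] (b : ℝ), I₀ L b = ∫ P, Real.exp (-(b * swapRingDeficit L (fun _ => false) P)) ∂(ringMeasure L) :=
    fun L _ b => by simp only [I₀, dif_neg (NeZero.ne L)]
  have hI₁ : ∀ (L : ℕ) [NeZero L] (b : ℝ), I₁ L b = ∫ P, Real.exp (-(b * swapRingDeficit L (fun k => decide (k = 2)) P)) ∂(ringMeasure L) :=
    fun L _ b => by simp only [I₁, dif_neg (NeZero.ne L)]
  -- the per-(L,b) data in terms of `I₀`, `I₁`
  have h₀' : ∀ L : ℕ, L₀ ≤ L → ∀ b : ℝ, K₁ * (L : ℝ) ^ q₁ ≤ b → ∃ Ib R : ℝ, Ib ≤ I₀ L b ∧ I₀ L b ≤ Ib + R ∧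
      |Ib - (2 * Real.pi / b) ^ (e₀ L) * 𝔐₀ L| ≤ (K₂ * (L : ℝ) ^ q₂ * b ^ (-(1 / 2 : ℝ))) * ((2 * Real.pi / b) ^ (e₀ L) * 𝔐₀ L) ∧
      R ≤ (K₃ * (L : ℝ) ^ q₃ * b ^ (-θ₃)) * ((2 * Real.pi / b) ^ (e₀ L) * 𝔐₀ L) := by
    intro L hL b hb
    haveI : NeZero L := ⟨by omega⟩
    rw [hI₀ L b]
    exact h₀ L hL b hb
  have h₁' : ∀ L : ℕ, L₀ ≤ L → ∀ b : ℝ, K₁ * (L : ℝ) ^ q₁ ≤ b → ∃ Ib R : ℝ, Ib ≤ I₁ L b ∧ I₁ L b ≤ Ib + R ∧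
      |Ib - (2 * Real.pi / b) ^ (e₁ L) * 𝔐₁ L| ≤ (K₂ * (L : ℝ) ^ q₂ * b ^ (-(1 / 2 : ℝ))) * ((2 * Real.pi / b) ^ (e₁ L) * 𝔐₁ L) ∧
      R ≤ (K₃ * (L : ℝ) ^ q₃ * b ^ (-θ₃)) * ((2 * Real.pi / b) ^ (e₁ L) * 𝔐₁ L) := by
    intro L hL b hb
    haveI : NeZero L := ⟨by omega⟩
    rw [hI₁ L b]
    exact h₁ L hL b hb
  -- the two window laws
  obtain ⟨a₀, ha₀, A₀, hA₀, p₀, t₀, ht₀, ht₀1, β₀, hS₀⟩ := sharpLaw_on_window_of_bulk_rest (I := I₀) hK₁ hK₂ hK₃ hθ₃ hq₁ hL₀ h𝔐₀ h₀'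
  obtain ⟨a₁, ha₁, A₁, hA₁, p₁, t₁, ht₁, ht₁1, β₁, hS₁⟩ := sharpLaw_on_window_of_bulk_rest (I := I₁) hK₁ hK₂ hK₃ hθ₃ hq₁ hL₀ h𝔐₁ h₁'
  -- common window ∕ constants
  set a : ℝ := min a₀ a₁ with hadef
  set A : ℝ := A₀ + A₁ with hAdef
  set p : ℕ := max p₀ p₁ with hpdef
  set t : ℝ := min t₀ t₁ with htdef
  set β : ℝ := max (max β₀ β₁) 1 with hβdef
  refine Summit.QuantumFields.YangMills.Theorems.VirialFluxGap.FrameHessian.swapMeanActionGap_of_sharpSectorLaplace ⟨a, lt_min ha₀ ha₁, A, by positivity, (p : ℝ), Nat.cast_nonneg _, t, lt_min ht₀ ht₁,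
    (min_le_left _ _).trans ht₀1, e₀, e₁, fun L => Real.log (𝔐₀ L) + e₀ L * Real.log (2 * Real.pi), fun L => Real.log (𝔐₁ L) + e₁ L * Real.log (2 * Real.pi),
    β, L₀, hexp, fun b hb L _ hL hLb => ?_⟩
  have hb1 : (1 : ℝ) ≤ b := (le_max_right _ _).trans hb
  have hbβ₀ : β₀ ≤ b := ((le_max_left _ _).trans (le_max_left _ _)).trans hb
  have hbβ₁ : β₁ ≤ b := ((le_max_right _ _).trans (le_max_left _ _)).trans hb
  have hL1 : (1 : ℝ) ≤ L := by exact_mod_cast hL₀.trans hL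
  have hLa₀ : (L : ℝ) ≤ b ^ a₀ := hLb.trans (Real.rpow_le_rpow_of_exponent_le hb1 (min_le_left _ _))
  have hLa₁ : (L : ℝ) ≤ b ^ a₁ := hLb.trans (Real.rpow_le_rpow_of_exponent_le hb1 (min_le_right _ _))
  obtain ⟨-, hlaw₀⟩ := hS₀ b hbβ₀ L hL hLa₀
  obtain ⟨-, hlaw₁⟩ := hS₁ b hbβ₁ L hL hLa₁
  rw [hI₀ L b] at hlaw₀
  rw [hI₁ L b] at hlaw₁
  -- enlarge both bounds to `A · L^p · b^{−t}`
  have hmono : 0 ≤ (L : ℝ) ^ p * b ^ (-t) := by positivity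
  have hbig₀ : A₀ * (L : ℝ) ^ p₀ * b ^ (-t₀) ≤ A * (L : ℝ) ^ (p : ℝ) * b ^ (-t) := by
    have h1 := monomial_le_of_window hA₀.le hL1 hb1 (le_max_left p₀ p₁) (min_le_left t₀ t₁)
    rw [Real.rpow_natCast]
    refine h1.trans ?_
    have : A₀ * (L : ℝ) ^ p * b ^ (-t) ≤ A * (L : ℝ) ^ p * b ^ (-t) := by
      rw [mul_assoc, mul_assoc]; exact mul_le_mul_of_nonneg_right (by rw [hAdef]; linarith) hmono
    exact this
  have hbig₁ : A₁ * (L : ℝ) ^ p₁ * b ^ (-t₁) ≤ A * (L : ℝ) ^ (p : ℝ) * b ^ (-t) := by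
    have h1 := monomial_le_of_window hA₁.le hL1 hb1 (le_max_right p₀ p₁) (min_le_right t₀ t₁)
    rw [Real.rpow_natCast]
    refine h1.trans ?_
    have : A₁ * (L : ℝ) ^ p * b ^ (-t) ≤ A * (L : ℝ) ^ p * b ^ (-t) := by
      rw [mul_assoc, mul_assoc]; exact mul_le_mul_of_nonneg_right (by rw [hAdef]; linarith) hmono
    exact this
  exact ⟨hlaw₀.trans hbig₀, hlaw₁.trans hbig₁⟩

end Summit.QuantumFields.YangMills.Theorems.SwapVirialDeficit.SwapRing

end
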